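import Literature.AnabelianGeometry.AbsoluteAnabelian.AbsTopIII.CyclotomicSynchronization
import Literature.NumberTheory.GaloisRepresentations.ContinuousCohomologyTowerLimit
import Literature.AnabelianGeometry.AbsoluteAnabelian.GaloisCyclotomeTowerLevels
import HarnessLib

/-!
# [AbsTopIII] Cor. 1.10 (i)(a): the Galois cyclotome `μ_Ẑ(G_k)` as the inverse limit of the `μ_{n!}(k̄)`

Mochizuki, *Topics in Absolute Anabelian Geometry III*, Cor. 1.10 (i)(a) p. 42 (lit key
`paper:url-5493eb38cbb7`) constructs "the natural isomorphism `H²(G_k, μ_Ẑ(G_k)) ⥲ Ẑ`" for an MLF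
`k`, where `μ_Ẑ(G_k) = Hom(ℚ/ℤ, μ_{ℚ/ℤ}(G_k))` is the GROUP-THEORETIC cyclotome (tree: `muZhat`,
`MuZhatMod`, `galCyclotomeTopRep` of abc-iut-L4-t1; the typed fact is `AbsTopIII.Cor_1_10_i_a`,
file `CyclotomicSynchronization.lean`).  Local class field theory identifies `μ_{ℚ/ℤ}(G_k)` with the
roots of unity `μ(k̄)` `G_k`-equivariantly ([AbsAnab] Prop. 1.2.1 (vi); tree:
`MLFGaloisCyclotomeIsRootsOfUnity`, PROVED `mlfGaloisCyclotomeIsRootsOfUnity_holds`).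

This file supplies the topological input for computing `H²(G_k, μ_Ẑ(G_k))` levelwise: GIVEN such an
equivariant identification `φ : μ_{ℚ/ℤ}(G_k) ≅ μ(k̄)` (a hypothesis here — any field `k` of
characteristic `0`), the topological representation `galCyclotomeTopRep G_k = μ_Ẑ(G_k)` IS the
inverse limit of the `ℕ`-tower of the finite discrete Galois modules `μ_{(i+1)!}(k̄)`
(`DiscreteGaloisModule.mu k (i+1)!`, transition = raising to the power `i + 2`, which is
SURJECTIVE on `μ(k̄)` as `k̄` is algebraically closed) in the sense of the tree's
`DiscreteTowerPresentation` (`ContinuousCohomologyTowerLimit.lean`, NSW (2.7.5)):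
`galCyclotomeTower k φ hφ`.  Ingredients: the factorial chain `cycLevel i = (i+1)!` (cofinal in `ℕ+`
for divisibility), the power maps `muPowHom` between the modules `μ_N(k̄) → μ_n(k̄)`, the
projections `cycProj φ i : μ_Ẑ(G_k) → μ_{(i+1)!}(k̄)` (`z ↦ φ(z_{(i+1)!})`), and the extension of a
chain-compatible family of roots of unity to an element of `μ_Ẑ(G_k)` (`cycLiftUnit`, `cycLift`).

HONEST FRAMING: classical, undisputed material ([AbsAnab] §1.2, local class field theory and
Pontryagin/Tate-module bookkeeping); nothing here bears on [IUTchIII] Cor. 3.12; no side taken.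

## References
* [MochizukiAbsTopIII2015] S. Mochizuki, *Topics in Absolute Anabelian Geometry III*, Cor. 1.10 (i)
  p. 41–42.
* [NeukirchSchmidtWingberg2008] J. Neukirch, A. Schmidt, K. Wingberg, *Cohomology of Number Fields*
  (2008), (2.7.5).
-/

noncomputable section

open CategoryTheory Function Topology

universe u

namespace Literature.AnabelianGeometry.AbsoluteAnabelian

open Field
open Literature.NumberTheory.GaloisRepresentations
open Literature.NumberTheory.GaloisRepresentations.DiscreteGaloisModule

/-! ### The Galois cyclotome `μ_Ẑ(G_k)` and a comparison `φ : μ_{ℚ/ℤ}(G_k) ≅ μ(k̄)` -/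

section Tower

variable (k : Type u) [Field k] [CharZero k]

variable {k}
variable (φ : muQZ (absoluteGaloisGroup k) ≃+ Additive (CommGroup.torsion (AlgebraicClosure k)ˣ))
  (hφ : ∀ (σ : absoluteGaloisGroup k) (x : muQZ (absoluteGaloisGroup k)),
    (((Additive.toMul (φ (σ • x)) : CommGroup.torsion (AlgebraicClosure k)ˣ) :
        (AlgebraicClosure k)ˣ) : AlgebraicClosure k) =
      σ • (((Additive.toMul (φ x) : CommGroup.torsion (AlgebraicClosure k)ˣ) :
        (AlgebraicClosure k)ˣ) : AlgebraicClosure k))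

/-- The unit of `k̄` attached through `φ` to the `n`-th component of `z ∈ μ_Ẑ(G_k)`.
[cite: MochizukiAbsTopIII2015, Cor 1.10 (i) p.41] -/
def componentUnit (n : ℕ+) (z : MuZhatMod (absoluteGaloisGroup k)) : (AlgebraicClosure k)ˣ :=
  ((Additive.toMul (φ (Multiplicative.toAdd ((z.toMuZhat : ℕ+ → Multiplicative (muQZ (absoluteGaloisGroup k))) n))) :
    CommGroup.torsion (AlgebraicClosure k)ˣ) : (AlgebraicClosure k)ˣ)

/-- `componentUnit` turns the (multiplicative) structure of `μ_Ẑ(G_k) ⊆ ∏_n μ_{ℚ/ℤ}(G_k)` into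
multiplication of units: general formula for a product of components.
[cite: MochizukiAbsTopIII2015, Cor 1.10 (i) p.41] -/
theorem coe_toMul_φ_mul (x y : Multiplicative (muQZ (absoluteGaloisGroup k))) :
    ((Additive.toMul (φ (Multiplicative.toAdd (x * y))) : CommGroup.torsion (AlgebraicClosure k)ˣ) :
        (AlgebraicClosure k)ˣ) =
      ((Additive.toMul (φ (Multiplicative.toAdd x)) : CommGroup.torsion (AlgebraicClosure k)ˣ) :
        (AlgebraicClosure k)ˣ) *
      ((Additive.toMul (φ (Multiplicative.toAdd y)) : CommGroup.torsion (AlgebraicClosure k)ˣ) :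
        (AlgebraicClosure k)ˣ) := by
  rw [toAdd_mul, map_add, toMul_add, Subgroup.coe_mul]

/-- The same for powers. [cite: MochizukiAbsTopIII2015, Cor 1.10 (i) p.41] -/
theorem coe_toMul_φ_pow (x : Multiplicative (muQZ (absoluteGaloisGroup k))) (d : ℕ) :
    ((Additive.toMul (φ (Multiplicative.toAdd (x ^ d))) : CommGroup.torsion (AlgebraicClosure k)ˣ) :
        (AlgebraicClosure k)ˣ) =
      ((Additive.toMul (φ (Multiplicative.toAdd x)) : CommGroup.torsion (AlgebraicClosure k)ˣ) :
        (AlgebraicClosure k)ˣ) ^ d := by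
  rw [toAdd_pow, map_nsmul, toMul_nsmul, Subgroup.coe_pow]

/-- `componentUnit n z ^ n = 1`. [cite: MochizukiAbsTopIII2015, Cor 1.10 (i) p.41] -/
theorem componentUnit_pow_eq_one (n : ℕ+) (z : MuZhatMod (absoluteGaloisGroup k)) : componentUnit φ n z ^ (n : ℕ) = 1 := by
  rw [componentUnit, ← coe_toMul_φ_pow, EtaleTheta.cyclotome.pow_eq_one]
  simp

/-- Compatibility along the chain: `componentUnit (n*m) z ^ m = componentUnit n z`.
[cite: MochizukiAbsTopIII2015, Cor 1.10 (i) p.41] -/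
theorem componentUnit_mul_pow (n m : ℕ+) (z : MuZhatMod (absoluteGaloisGroup k)) :
    componentUnit φ (n * m) z ^ (m : ℕ) = componentUnit φ n z := by
  rw [componentUnit, componentUnit, ← coe_toMul_φ_pow, EtaleTheta.cyclotome.pow_apply_mul]

/-- Compatibility along the factorial chain: `componentUnit ((i+2)!) z ^ (i+2) = componentUnit ((i+1)!) z`.
[cite: MochizukiAbsTopIII2015, Cor 1.10 (i) p.41] -/
theorem componentUnit_cycLevel_succ_pow (i : ℕ) (z : MuZhatMod (absoluteGaloisGroup k)) :
    componentUnit φ (cycLevel (i + 1)) z ^ (i + 2) = componentUnit φ (cycLevel i) z :=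
  componentUnit_mul_pow φ (cycLevel i) ⟨i + 2, by omega⟩ z

/-- `componentUnit` at a divisor of a chain level, from the chain level.
[cite: MochizukiAbsTopIII2015, Cor 1.10 (i) p.41] -/
theorem componentUnit_eq_pow_of_dvd {n N : ℕ+} (h : (n : ℕ) ∣ (N : ℕ)) (z : MuZhatMod (absoluteGaloisGroup k)) :
    componentUnit φ n z = componentUnit φ N z ^ ((N : ℕ) / n) := by
  obtain ⟨d, hd⟩ := h
  have hdpos : 0 < d := Nat.pos_of_ne_zero (by rintro rfl; simp at hd)
  let d' : ℕ+ := ⟨d, hdpos⟩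
  have hN : N = n * d' := PNat.eq (by rw [PNat.mul_coe]; exact hd)
  subst hN
  have he : ((n * d' : ℕ+) : ℕ) / n = (d' : ℕ) := by
    rw [PNat.mul_coe, Nat.mul_div_cancel_left _ n.pos]
  rw [he]
  exact (componentUnit_mul_pow φ n d' z).symm

/-- `componentUnit` is multiplicative in `z` (additive structure of `MuZhatMod`).
[cite: MochizukiAbsTopIII2015, Cor 1.10 (i) p.41] -/
theorem componentUnit_add (n : ℕ+) (z z' : MuZhatMod (absoluteGaloisGroup k)) :
    componentUnit φ n (z + z') = componentUnit φ n z * componentUnit φ n z' := by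
  rw [componentUnit, componentUnit, componentUnit, ← coe_toMul_φ_mul]
  rfl

include hφ in
/-- `componentUnit` is `G_k`-equivariant (the conjugation action on `μ_Ẑ(G_k)` versus the Galois
action on `k̄ˣ`), by the equivariance of `φ`. [cite: MochizukiAbsTopIII2015, Cor 1.10 (i) p.42] -/
theorem componentUnit_smul (n : ℕ+) (σ : (absoluteGaloisGroup k)) (z : MuZhatMod (absoluteGaloisGroup k)) :
    componentUnit φ n (galCyclotomeRep (absoluteGaloisGroup k) σ z) = σ • componentUnit φ n z := by
  apply Units.ext
  rw [Units.coe_smul, componentUnit, componentUnit, ← hφ]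
  rfl

/-- The projection `μ_Ẑ(G_k) → μ_{(i+1)!}(k̄)` on elements: `z ↦ φ(z_{(i+1)!})`.
[cite: MochizukiAbsTopIII2015, Cor 1.10 (i) p.41] -/
def cycProjFun (n : ℕ+) (z : MuZhatMod (absoluteGaloisGroup k)) : MuCarrier k n :=
  MuCarrier.ofRootsOfUnity ⟨componentUnit φ n z, (mem_rootsOfUnity _ _).2
    (componentUnit_pow_eq_one φ n z)⟩

/-- `muVal (cycProjFun n z) = componentUnit n z`. [cite: MochizukiAbsTopIII2015, Cor 1.10 (i) p.41] -/
@[simp] theorem muVal_cycProjFun (n : ℕ+) (z : MuZhatMod (absoluteGaloisGroup k)) :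
    muVal k n (cycProjFun φ n z) = componentUnit φ n z := rfl

/-- `cycProjFun` is continuous: it factors through the (continuous) component map into the DISCRETE
`μ_{ℚ/ℤ}(G_k)`. [cite: MochizukiAbsTopIII2015, Cor 1.10 (i) p.41] -/
theorem continuous_cycProjFun (n : ℕ+) : Continuous (cycProjFun (k := k) φ n) := by
  classical
  let F : Multiplicative (muQZ (absoluteGaloisGroup k)) → MuCarrier k n := fun x =>
    if h : ((Additive.toMul (φ (Multiplicative.toAdd x)) : CommGroup.torsion (AlgebraicClosure k)ˣ) :
        (AlgebraicClosure k)ˣ) ^ (n : ℕ) = 1 then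
      MuCarrier.ofRootsOfUnity ⟨_, (mem_rootsOfUnity _ _).2 h⟩ else 0
  have hF : ∀ z : MuZhatMod (absoluteGaloisGroup k),
      cycProjFun φ n z = F ((z.toMuZhat : ℕ+ → Multiplicative (muQZ (absoluteGaloisGroup k))) n) := fun z => by
    have h := componentUnit_pow_eq_one φ n z
    unfold componentUnit at h
    simp only [F, dif_pos h]
    rfl
  rw [show cycProjFun (k := k) φ n = F ∘ fun z => (z.toMuZhat : ℕ+ → Multiplicative (muQZ (absoluteGaloisGroup k))) n
    from funext hF]
  exact continuous_of_discreteTopology.comp (MuZhatMod.continuous_apply n)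

/-- `componentUnit n 0 = 1`. [cite: MochizukiAbsTopIII2015, Cor 1.10 (i) p.41] -/
theorem componentUnit_zero (n : ℕ+) : componentUnit φ n (0 : MuZhatMod (absoluteGaloisGroup k)) = 1 := by
  have h := componentUnit_add φ n (0 : MuZhatMod (absoluteGaloisGroup k)) 0
  rw [add_zero] at h
  exact mul_left_cancel (h.symm.trans (mul_one _).symm)

/-- The projection `μ_Ẑ(G_k) → μ_n(k̄)` as an additive homomorphism.
[cite: MochizukiAbsTopIII2015, Cor 1.10 (i) p.41] -/
def cycProjAddHom (n : ℕ+) : MuZhatMod (absoluteGaloisGroup k) →+ MuCarrier k n where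
  toFun := cycProjFun φ n
  map_zero' := muVal_injective k n (by rw [muVal_cycProjFun, muVal_zero, componentUnit_zero])
  map_add' z z' := muVal_injective k n (by
    rw [muVal_add, muVal_cycProjFun, muVal_cycProjFun, muVal_cycProjFun, componentUnit_add])

include hφ in
/-- **The projection `μ_Ẑ(G_k) → μ_n(k̄)`** as a morphism of topological representations of `G_k`
(additive, continuous, equivariant). [cite: MochizukiAbsTopIII2015, Cor 1.10 (i) p.42] -/
def cycProj (n : ℕ+) : galCyclotomeTopRep (absoluteGaloisGroup k) ⟶ (mu k n).toTopRep :=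
  TopRep.ofHom ⟨⟨(cycProjAddHom φ n).toIntLinearMap, continuous_cycProjFun φ n⟩, fun σ => by
    ext z
    apply muVal_injective k n
    change muVal k n (cycProjFun φ n (galCyclotomeRep (absoluteGaloisGroup k) σ z)) = muVal k n (mu k n σ (cycProjFun φ n z))
    rw [muVal_apply, muVal_cycProjFun, muVal_cycProjFun, componentUnit_smul φ hφ]⟩

/-- `cycProj` on elements. [cite: MochizukiAbsTopIII2015, Cor 1.10 (i) p.42] -/
@[simp] theorem muVal_cycProj_hom (n : ℕ+) (z : MuZhatMod (absoluteGaloisGroup k)) :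
    muVal k n ((cycProj φ hφ n).hom z) = componentUnit φ n z := rfl

end Tower

section TowerLift

variable {k : Type u} [Field k] [CharZero k]

variable (φ : muQZ (absoluteGaloisGroup k) ≃+ Additive (CommGroup.torsion (AlgebraicClosure k)ˣ))
  (hφ : ∀ (σ : absoluteGaloisGroup k) (x : muQZ (absoluteGaloisGroup k)),
    (((Additive.toMul (φ (σ • x)) : CommGroup.torsion (AlgebraicClosure k)ˣ) :
        (AlgebraicClosure k)ˣ) : AlgebraicClosure k) =
      σ • (((Additive.toMul (φ x) : CommGroup.torsion (AlgebraicClosure k)ˣ) :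
        (AlgebraicClosure k)ˣ) : AlgebraicClosure k))
variable (s : ∀ i, MuCarrier k (cycLevel i)) (hs : IsChainCompatible s)

/-- The extension of a chain-compatible family to a family indexed by `ℕ+`, transported back to
`μ_{ℚ/ℤ}(G_k)` through `φ`. [cite: MochizukiAbsTopIII2015, Cor 1.10 (i) p.41] -/
def cycLiftFun (n : ℕ+) : Multiplicative (muQZ (absoluteGaloisGroup k)) :=
  Multiplicative.ofAdd (φ.symm (Additive.ofMul (cycLiftTorsion s n)))

/-- The `φ`-image of `cycLiftFun n` is `u_n`. [cite: MochizukiAbsTopIII2015, Cor 1.10 (i) p.41] -/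
theorem coe_toMul_φ_cycLiftFun (n : ℕ+) :
    ((Additive.toMul (φ (Multiplicative.toAdd (cycLiftFun φ s n))) :
      CommGroup.torsion (AlgebraicClosure k)ˣ) : (AlgebraicClosure k)ˣ) = cycLiftUnit s n := by
  simp [cycLiftFun, cycLiftTorsion]

/-- Injectivity of `x ↦ φ(x)` read on units. [cite: MochizukiAbsTopIII2015, Cor 1.10 (i) p.41] -/
theorem eq_of_coe_toMul_φ_eq {x y : Multiplicative (muQZ (absoluteGaloisGroup k))}
    (h : ((Additive.toMul (φ (Multiplicative.toAdd x)) : CommGroup.torsion (AlgebraicClosure k)ˣ) :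
        (AlgebraicClosure k)ˣ) =
      ((Additive.toMul (φ (Multiplicative.toAdd y)) : CommGroup.torsion (AlgebraicClosure k)ˣ) :
        (AlgebraicClosure k)ˣ)) : x = y :=
  Multiplicative.toAdd.injective (φ.injective (Additive.toMul.injective (Subtype.ext h)))

include hs in
/-- **The extension lies in `μ_Ẑ(G_k)`** (torsion levels and compatibilities).
[cite: MochizukiAbsTopIII2015, Cor 1.10 (i) p.41] -/
theorem cycLiftFun_mem : cycLiftFun φ s ∈ muZhat (absoluteGaloisGroup k) := by
  refine (mem_muZhat_iff (absoluteGaloisGroup k) _).2 ⟨fun n => ?_, fun n m => ?_⟩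
  · apply eq_of_coe_toMul_φ_eq φ
    rw [coe_toMul_φ_pow, coe_toMul_φ_cycLiftFun, cycLiftUnit_pow s]
    simp
  · apply eq_of_coe_toMul_φ_eq φ
    rw [coe_toMul_φ_pow, coe_toMul_φ_cycLiftFun, coe_toMul_φ_cycLiftFun, cycLiftUnit_mul_pow s hs]

/-- The extension as an element of `μ_Ẑ(G_k)` (additive notation).
[cite: MochizukiAbsTopIII2015, Cor 1.10 (i) p.41] -/
def cycLift (hs : IsChainCompatible s) : MuZhatMod (absoluteGaloisGroup k) :=
  MuZhatMod.ofMuZhat ⟨cycLiftFun φ s, cycLiftFun_mem φ s hs⟩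

include hs in
/-- The extension has the prescribed chain components.
[cite: MochizukiAbsTopIII2015, Cor 1.10 (i) p.41] -/
theorem componentUnit_cycLift (i : ℕ) :
    componentUnit φ (cycLevel i) (cycLift φ s hs) = muVal k _ (s i) := by
  change ((Additive.toMul (φ (Multiplicative.toAdd (cycLiftFun φ s (cycLevel i)))) :
    CommGroup.torsion (AlgebraicClosure k)ˣ) : (AlgebraicClosure k)ˣ) = _
  rw [coe_toMul_φ_cycLiftFun, cycLiftUnit_eq s hs (cycLevel i) dvd_rfl, Nat.div_self (cycLevel i).pos,
    pow_one]

/-! ### The tower -/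

/-- **`μ_Ẑ(G_k) = lim_{← i} μ_{(i+1)!}(k̄)` as topological representations of `G_k`**: given a
`G_k`-equivariant identification `φ : μ_{ℚ/ℤ}(G_k) ≅ μ(k̄)` (local class field theory for an MLF,
`MLFGaloisCyclotomeIsRootsOfUnity`), the Galois cyclotome `galCyclotomeTopRep G_k` (abc-iut-L4-t1,
[AbsTopIII] Cor. 1.10 (i)(a)) is presented as the inverse limit of the `ℕ`-tower of the finite
DISCRETE Galois modules `μ_{(i+1)!}(k̄)` with the (surjective) power maps as transitions, in the sense
of `DiscreteTowerPresentation` (so that `H²(G_k, μ_Ẑ(G_k)) ≅ lim_i H²(G_k, μ_{(i+1)!})` by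
`DiscreteTowerPresentation.limitClassesEquiv`, NSW (2.7.6)).
[cite: MochizukiAbsTopIII2015, Cor 1.10 (i) p.42] -/
def galCyclotomeTower : DiscreteTowerPresentation (galCyclotomeTopRep (absoluteGaloisGroup k)) where
  obj i := (mu k (cycLevel i)).toTopRep
  tr i := muPowHom k (cycLevel (i + 1)) (cycLevel i) (i + 2) (by rw [cycLevel_succ]; rfl)
  proj i := cycProj φ hφ (cycLevel i)
  tr_proj i z := muVal_injective k _ (by
    rw [muPowHom_hom_apply, muVal_muPow, muVal_cycProj_hom, muVal_cycProj_hom]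
    exact componentUnit_cycLevel_succ_pow φ i z)
  discrete i := inferInstanceAs (DiscreteTopology (MuCarrier k (cycLevel i)))
  continuous_action i := (mu k (cycLevel i)).continuous_smul
  tr_surjective i := muPow_surjective k (by rw [cycLevel_succ]; rfl) (by omega)
  proj_injective z z' h := by
    have hc : ∀ n, componentUnit φ n z = componentUnit φ n z' := fun n => by
      rw [componentUnit_eq_pow_of_dvd φ (dvd_cycLevel_natPred n),
        componentUnit_eq_pow_of_dvd φ (dvd_cycLevel_natPred n), ← muVal_cycProj_hom φ hφ,
        ← muVal_cycProj_hom φ hφ, h]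
    have hz : z.toMuZhat = z'.toMuZhat :=
      Subtype.ext (funext fun n => eq_of_coe_toMul_φ_eq φ (hc n))
    exact congrArg MuZhatMod.ofMuZhat hz
  proj_lift s hs := by
    have hs' : IsChainCompatible s := fun i => by
      have h := congrArg (muVal k (cycLevel i)) (hs i)
      exact h
    exact ⟨cycLift φ s hs', fun i => muVal_injective k _ (by
      rw [muVal_cycProj_hom, componentUnit_cycLift])⟩
  isInducing := by
    -- the embedding `μ_Ẑ(G) ⊆ ∏_{n ∈ ℕ+} μ_{ℚ/ℤ}(G)` is inducing ...
    have he : IsInducing fun z : MuZhatMod (absoluteGaloisGroup k) =>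
        ((MuZhatMod.toMuZhat z : muZhat (absoluteGaloisGroup k)) : ℕ+ → Multiplicative (muQZ (absoluteGaloisGroup k))) :=
      IsInducing.subtypeVal.comp ⟨by
        show _ = TopologicalSpace.induced (id : muZhat (absoluteGaloisGroup k) → muZhat (absoluteGaloisGroup k)) _
        rw [induced_id]; rfl⟩
    -- ... and factors continuously through the chain projections
    let g : (∀ i, MuCarrier k (cycLevel i)) → (ℕ+ → Multiplicative (muQZ (absoluteGaloisGroup k))) := fun t n =>
      Multiplicative.ofAdd (φ.symm (Additive.ofMul
        ⟨muVal k _ (t n.natPred) ^ ((cycLevel n.natPred : ℕ) / n), (CommGroup.mem_torsion _).2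
          (isOfFinOrder_iff_pow_eq_one.2 ⟨n, n.pos, by
            rw [← pow_mul, Nat.div_mul_cancel (dvd_cycLevel_natPred n), muVal_pow_eq_one]⟩)⟩))
    have hg : Continuous g := continuous_pi fun n =>
      (continuous_of_discreteTopology (f := fun v : MuCarrier k (cycLevel n.natPred) =>
        Multiplicative.ofAdd (φ.symm (Additive.ofMul ⟨muVal k _ v ^ ((cycLevel n.natPred : ℕ) / n),
          (CommGroup.mem_torsion _).2 (isOfFinOrder_iff_pow_eq_one.2
            ⟨n, n.pos, by
              rw [← pow_mul, Nat.div_mul_cancel (dvd_cycLevel_natPred n), muVal_pow_eq_one]⟩)⟩)))).comp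
        (continuous_apply n.natPred)
    refine IsInducing.of_comp ?_ hg ?_
    · exact continuous_pi fun i => (cycProj φ hφ (cycLevel i)).hom.continuous
    · convert he using 1
      funext z
      funext n
      change Multiplicative.ofAdd (φ.symm (Additive.ofMul ⟨muVal k _ ((cycProj φ hφ _).hom z) ^ _, _⟩)) = _
      apply eq_of_coe_toMul_φ_eq φ
      simp only [toAdd_ofAdd, AddEquiv.apply_symm_apply, toMul_ofMul]
      rw [muVal_cycProj_hom, ← componentUnit_eq_pow_of_dvd φ (dvd_cycLevel_natPred n)]
      rfl

end TowerLift

end Literature.AnabelianGeometry.AbsoluteAnabelian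

end
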